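import Summits.CriticalPhenomena.SAWScalingLimit.Theorems.SAWLeftRightFKGLeftRightFKGNotchedBoxWalk
import Summits.CriticalPhenomena.SAWScalingLimit.Theorems.SAWLeftRightFKGLeftRightFKGNotchThreePoint
import Summits.CriticalPhenomena.SAWScalingLimit.Theorems.SAWLeftRightFKGLeftRightFKGNotchUpClosed
import HarnessLib

/-!
# Left–right association AT FUGACITY `x` ⇒ the two-chain three-point inequality at fugacity `x` on every notched box

Crux `stmt-CriticalPhenomena-11232` (`LeftRightFKG`), line `corner-localisation`, lead c4. The fugacity-`x` companion of
`Families.notchThreePoint` (`…NotchThreePointGlue.lean`): the graded association statement `CornerLoc.PA x` of the line's vocabulary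
(`…Defs.lean`; at `k = m = 0`, `Sa = Sb = univ` it is the crux at fugacity `x`) implies, on every notched box
`box ∖ {(x_s, y₀+1)}` realised as `dom C 1` (`Families.stub_notchedBoxWalk`), the inequality
`Z_G(W,v)·(Z_G(v,E_b) + Z_G(v,N_b)) ≤ Z_G(W,E_b) + Z_G(W,N_b)` for the fugacity-`x` self-avoiding path kernel of the free graph
(`Families.stub_notchUpClosed`, `Families.stub_notchThreePointOfIneq`, which are fugacity-free). This is the first input of the
x_c-SHARPNESS programme for the crux itself: in the dense phase `x > x_c` the two sides scale like `e^{2fA}` vs `e^{fA}` (the remaining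
input being the thermodynamic limit of supercritical two-point SAW kernels in boxes, positive by DKY Prop. 3 + the Prop. 7 claim, both in
the tree), so `PA x` must fail above `x_c`. Elementary given the landed stubs ("folklore").
-/

noncomputable section

open MeasureTheory
open Literature.Probability.LatticeModels Literature.Probability.RandomPlanarGeometry
open Summit.CriticalPhenomena.SAWScalingLimit.Theorems.LeftRightFKG.Negative (bx pathCross wcross)
open Summit.CriticalPhenomena.SAWScalingLimit.Theorems.LeftRightFKG.CornerLoc
open Summit.CriticalPhenomena.SAWScalingLimit.Theorems.BoundaryTP2 (pathKernel pathKernelOn)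
open scoped Classical ENNReal

namespace Summit.CriticalPhenomena.SAWScalingLimit.Theorems.LeftRightFKG.Families

/-- **`PA x` ⇒ the two-chain three-point inequality at fugacity `x` on every notched box.** For `0 < x`, the graded left–right
association statement `CornerLoc.PA x` and walls with `x₀ + 2 < x_s`, `x_s + 1 < x₁`, `y₀ + 3 < y₁`: there is a closed lattice walk
realising `box ∖ {(x_s, y₀+1)}` as `dom C 1` on which `Z_G(W,v)·(Z_G(v,E_b) + Z_G(v,N_b)) ≤ Z_G(W,E_b) + Z_G(W,N_b)` holds for the
fugacity-`x` kernel of the free graph of the diagonal marked pair `a = (x_s-1,y₀+1)`, `b = (x_s,y₀+2)`. [folklore] -/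
theorem notchThreePoint_of_PA : ∀ (x : ℝ), 0 < x → PA x →
    ∀ (x₀ x₁ y₀ y₁ x_s : ℤ), x₀ + 2 < x_s → x_s + 1 < x₁ → y₀ + 3 < y₁ →
    ∃ C : (zdGraph 2).Walk (bx x₀ y₀) (bx x₀ y₀),
      meshDomain (dom C 1) 1 = Negative.Rect.box x₀ x₁ y₀ y₁ \ {bx x_s (y₀ + 1)} ∧
      ∀ G : SimpleGraph (Site 2),
        G = freeGraph (dom C 1) 1 0 (fun _ => bx (x_s - 1) (y₀ + 1)) 0 (fun _ => bx x_s (y₀ + 2)) →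
        pathKernel G x (bx (x_s - 2) (y₀ + 1)) (bx (x_s - 1) (y₀ + 2)) *
            (pathKernel G x (bx (x_s - 1) (y₀ + 2)) (bx (x_s + 1) (y₀ + 2)) +
              pathKernel G x (bx (x_s - 1) (y₀ + 2)) (bx x_s (y₀ + 3))) ≤
          pathKernel G x (bx (x_s - 2) (y₀ + 1)) (bx (x_s + 1) (y₀ + 2)) +
            pathKernel G x (bx (x_s - 2) (y₀ + 1)) (bx x_s (y₀ + 3)) := by
  intro x hx hPA x₀ x₁ y₀ y₁ x_s h₁ h₂ h₃
  obtain ⟨C, ha', hs, hdom, hadj⟩ := stub_notchedBoxWalk x₀ x₁ y₀ y₁ x_s (by omega) (by omega) (by omega)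
  refine ⟨C, hdom, fun G hG => ?_⟩
  obtain ⟨hE, hF⟩ := stub_notchUpClosed x₀ x₁ y₀ y₁ x_s C h₁ h₂ h₃ hadj
  have hInst : IsInst 1 (bx (x_s - 1) (y₀ + 1)) (bx x_s (y₀ + 2)) (bx (x_s - 1) y₀) (bx x_s (y₀ + 1)) C :=
    ⟨one_pos, ha', hs, Negative.adj_bx _ _ _ _ (by omega), Negative.adj_bx _ _ _ _ (by omega)⟩
  have key := hPA 1 (bx x₀ y₀) (bx (x_s - 1) (y₀ + 1)) (bx x_s (y₀ + 2)) (bx (x_s - 1) y₀) (bx x_s (y₀ + 1)) C hInst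
    0 (fun _ => bx (x_s - 1) (y₀ + 1)) 0 (fun _ => bx x_s (y₀ + 2)) Set.univ Set.univ _ _
    (isUpOn_of_isUp hE) (isUpOn_of_isUp hF) (by simp) (by simp)
  simp only [restrP_zero_univ, Set.inter_univ] at key
  exact stub_notchThreePointOfIneq x x₀ x₁ y₀ y₁ x_s C hx h₁ h₂ h₃ hadj key G hG

end Summit.CriticalPhenomena.SAWScalingLimit.Theorems.LeftRightFKG.Families

end
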